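import Summits.QuantumFields.YangMills.Theorems.BalabanUVNodesN07T47ChartAverage
import Literature.MathematicalPhysics.QuantumFieldTheory.Balaban1983to89.Node00.BgSchemePrOfRecord
import Literature.MathematicalPhysics.QuantumFieldTheory.Balaban1983to89.B15Prop1DatumCoordinates
import HarnessLib

/-!
# N07 at the record — THE (47)-CARRYING CHART ON THE UN-FRAMED SCHEME OF RECORD `bgSchemeOfRecord` ((A4)'s generic `BgScheme.chartLin` with the frame-free
# slot `T♭ := T47 H₁♭ C^{sl} ε_C`): the KNIT token (rng)'s average conjunct `Ū^k(𝔖♭.chartCfgLin T♭ V) = V` AT THE FIXED POINT, by name, with the guard and the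
# A-side log-disc row discharged in the small

Cell `pub-ymgap`, seat `pub-ymgap-dag-n07-w3` (g28, WIDTH SEAT 3 on N07 [B11]); helper file keyed `--supports stmt-QuantumFields-27238 --as helper` (K0ᴬ road);
count-neutral.  INTENT-15 of the seat.  WHY THIS EDITION: def-Y's (A4) typed the chart letters `chartLin ∕ chartCfgLin ∕ expoLinAt` GENERICALLY over any
`BgScheme` and any slot `T`, and instantiated the slot at the FRAMED Sect. C pair; the K0ᴬ road's finals of this lineage (g27's ✓p826083…✓p827690, the
porter's `_modGauge` pair) are typed over the UN-FRAMED `bgSchemeOfRecord`, whose (rng) display is the UN-FRAMED `Averaging.iter … = V` — and for that scheme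
every supporting row is ALREADY a frame-free letter of the tree: (109) ✓`bgSchemeOfRecord_Q_sol` (slot-(c) slice token `FrakGSliceTok`), (48) + the bridge
✓`iterMh_T47_eq_of_logDisc`, ✓`iter_T47Chart_eq`, the reality ∕ trace rows of `T47` (g26 ✓`conjJet_T47OfRecord_eq`, g27 ✓`trace_equiv_T47OfRecord_eq_zero_two`).
So the consumer's swap is `S.chart ↦ S.chartLin T♭`, `S.chartCfg ↦ S.chartCfgLin T♭` with `S := bgSchemeOfRecord …` unchanged — no frame, no frame flag.

## What is here (slot written inline as the constant family `fun _ => T47 (H1OfRecordAtBgFlat …) (CslOfRecord …) ε_C`; no `def`)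

* §1 ★ `coeField_chartLinFlat_eq_expOver` — the matrices of the (47)-carrying chart of the un-framed scheme on `SU`-valued exponents:
  `↑(𝔖♭.chartLin T♭ V A) = expOver U₀ (η • evLit (T47 H₁♭ C^{sl} ε_C (A + 𝔄♭ V)))` ((A4) ✓`BgScheme.coe_chartLin_of_mem`).
* §1 ★★★ `iter_chartCfgLinFlat_eq` — ✓`iter_T47Chart_eq` AT THE CHART: under the scheme `Regime`, `‖J‖ ≤ j`, `‖𝔄♭V‖ < a𝔄`, `FrakGSliceTok`, the Sect. C `Regime` with
  `ε₄ + a𝔄 ≤ a_C`, the trace row, the `SU`-exponent row, the guard below `k` for the chart field and the two log-disc rows: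
  **`Averaging.iter (avOfRecord F N K) k (𝔖♭.chartCfgLin T♭ V) = V`** — the K0ᴬ road's (rng) ∧ (star_mem) average conjunct VERBATIM for the un-framed scheme.
* §2 (rows in the small) ★★ `eventually_rowsFlat_nhds_bg` (guard + A-side log-disc row for matrix fields near `↑U₀`: lit ✓`eventually_smallBelow`, continuity of `Ū^k_h`
  at `↑U₀` — lit ✓`analyticAt_iterMh_of_polydisc`), ★ `tendsto_chartFieldFlat_zero` (lit ✓`analyticOnNhd_T47`, ✓`T47_zero`), ★★ `exists_radius_rowsFlat` (ONE `ρ > 0`,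
  `ρ ≤ a_C`, from the background and the Sect. C data only), ★★★ `exists_radius_iter_chartCfgLinFlat_eq` — `iter_chartCfgLinFlat_eq` with the guard and the A-side
  log-disc row REMOVED: for every scheme regime with `ε₄ + a𝔄 ≤ ρ` and every `V ∈ logDiscOfRecord F N K k U₀` with `‖𝔄♭V‖ < a𝔄`.

## Honest labels

Re-keying of landed frame-free theorems on (A4)'s generic chart letters + continuity bookkeeping.  REMAINING displayed rows: the two `Regime`s + `Prop4Hyp` (produced in the
small frame-free by this lineage's Sect. C files), `‖J‖ ≤ j`, `FrakGSliceTok` (slot (c); discharged at slot (a) by ✓`…N07FrakGOfRecordSliceFlat`), the trace row and the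
`SU`-exponent row (reality + trace of `T47(𝒜♭ + 𝔄♭)`: g26∕g27 rows, `N = 2` for the trace).  Nothing of Bałaban's estimates; K0ᴬ ⟨27238⟩ NOT closed; N07 NOT discharged;
R4 is the conditional finite-𝕋⁴ rung `BalabanLadder.UV` only; finite torus at fixed `ε` — nothing continuum ∕ OS ∕ Clay.  **The Yang–Mills mass gap is NOT proved by any
of this.**  No `sorry`, no `def`, no `instance ∕ notation`; standard axioms.
[cite: Balaban1985Variational, (15) p.280, (20) p.281, (44)–(48) p.285, (103) p.293, (109)–(111) p.294, Prop. 6 (115)–(116) p.295; Balaban1987RG1, (0.4) p.253, (0.21) p.256;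
Balaban1985Averaging, (21) p.21]
-/

set_option autoImplicit false

noncomputable section

open scoped Matrix Matrix.Norms.L2Operator InnerProductSpace Topology

namespace Summit.QuantumFields.YangMills.Theorems.N07ChartLinAverageFlat

open Filter Metric
open Literature.MathematicalPhysics.QuantumFieldTheory.Balaban1983to89
open Literature.MathematicalPhysics.QuantumFieldTheory.Balaban1983to89.T4Continuum (T4Family)
open Literature.MathematicalPhysics.QuantumFieldTheory.Balaban1983to89.Node00
open BlockAveraging (Idx)
open B15AveragingHolomorphic (iterMh loopMh)
open B15AveragingAnalytic (analyticAt_iterMh_of_polydisc)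
open B15Prop1DatumCoordinates (eventually_smallBelow norm_loopMh_iterMh_lt_of_smallBelow deltaSU_le_one)
open B11Eq103H1Complex (SiteL2K BondL2K)
open B11Eq111FrakG (nabla115)
open B11Eq115Space (JetSup)
open B11Eq174Chart (Regime)
open B11Prop6Scheme (Prop4Hyp)
open B11Eq90V0GroupComposed (T47 T47_zero analyticOnNhd_T47)
open Summit.QuantumFields.YangMills.Theorems.N07T47ChartAverage (iter_T47Chart_eq)

section Record

variable (F : T4Family) (N : ℕ) [NeZero N] (K : ℕ) (k : ℕ) (Ω : ℕ → Set (Site (F.P K) 0)) (U₀ : GaugeField (F.P K) 0 (SU N))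
  [Fact (0 < (F.L : ℝ))] [Fact (0 < (F.P K).eta k)] [Fact (0 < c0Rec F K k)] [Fact (∀ c, 0 < wBRec F K k c)]
  (levB : PBond (F.P K) k → ℕ) (a : ℝ)
  (hposb : ∀ x, x ≠ 0 → 0 < RCLike.re ⟪x, laplaceAOfRecord F N k U₀ (QOfRecord F N k U₀) (QflatOfRecord F N k) a x⟫_ℂ)
  (hQ : Function.Surjective (QOfRecord F N k U₀))
  (Gp : SiteL2K ℂ (F.P K).d (fun _ => (F.P K).sitesPerDir 0) (c0Rec F K k) (WRec N) →ₗ[ℂ]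
    SiteL2K ℂ (F.P K).d (fun _ => (F.P K).sitesPerDir 0) (c0Rec F K k) (WRec N))
  (Δ2 : BondL2K ℂ (F.P K).d (fun _ => (F.P K).sitesPerDir 0) (c0Rec F K k) (WRec N) →ₗ[ℂ]
    BondL2K ℂ (F.P K).d (fun _ => (F.P K).sitesPerDir 0) (c0Rec F K k) (WRec N))
  (hposπ : ∀ x, x ≠ 0 → 0 < RCLike.re ⟪x, laplaceAOfRecordAt F N k U₀ (hessOpOfRecord128 F N k U₀ Gp (QflatOfRecord F N k) Δ2)
    (QOfRecord F N k U₀) (QflatOfRecord F N k) a x⟫_ℂ)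

/-! ## §1  The (47)-carrying chart of the un-framed scheme and (rng)'s average conjunct at its fixed point -/

/-- ★ **THE MATRICES OF THE (47)-CARRYING CHART OF THE UN-FRAMED SCHEME**: on an `SU(N)`-valued exponent,
`↑(𝔖♭.chartLin T♭ V A) = expOver U₀ (η • evLit (T47 H₁♭ C^{sl} ε_C (A + 𝔄♭ V)))` ((A4)'s generic `coe_chartLin_of_mem`; `𝔖♭.ev = η•evLit`, `𝔖♭.bg V = U₀`).
[cite: Balaban1985Variational, (15) p.280, (19) p.281, (47) p.285, (74) p.289] -/
theorem coeField_chartLinFlat_eq_expOver (dom : Set (GaugeField (F.P K) k (SU N))) {εC B₀ C₄ a₃ j a𝔄 ε₄ : ℝ}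
    (V : GaugeField (F.P K) k (SU N)) (A : Space115Lit F N K k Ω U₀)
    (hSU : ∀ b, (bgSchemeOfRecord F N K k Ω U₀ dom levB Gp Δ2 a hposπ hposb hQ εC B₀ C₄ a₃ j a𝔄 ε₄).expoLinAt
      (fun _ => T47 (H1OfRecordAtBgFlat F N K k Ω U₀ levB a hposb hQ) (CslOfRecord F N K k Ω U₀ levB) εC) V A b ∈ Matrix.specialUnitaryGroup (Fin N) ℂ) :
    coeField ((bgSchemeOfRecord F N K k Ω U₀ dom levB Gp Δ2 a hposπ hposb hQ εC B₀ C₄ a₃ j a𝔄 ε₄).chartLin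
        (fun _ => T47 (H1OfRecordAtBgFlat F N K k Ω U₀ levB a hposb hQ) (CslOfRecord F N K k Ω U₀ levB) εC) V A) =
      expOver U₀ ((((F.P K).eta k : ℝ) : ℂ) • evLit F N K k Ω U₀
        (T47 (H1OfRecordAtBgFlat F N K k Ω U₀ levB a hposb hQ) (CslOfRecord F N K k Ω U₀ levB) εC
          (A + frakAOfRecordAtBg128 F N K k Ω U₀ levB Gp Δ2 a hposπ hQ V))) := by
  funext b
  rw [coeField_apply, BgScheme.coe_chartLin_of_mem _ _ (hSU b), expOver_apply]
  rfl

/-- ★★★ **THE K0ᴬ ROAD's (rng) ∧ (star_mem) AVERAGE CONJUNCT AT THE FIXED POINT OF THE UN-FRAMED SCHEME, (47)-CARRYING CHART**: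
`Ū^k(𝔖♭.chartCfgLin T♭ V) = V` — this lineage's ✓`iter_T47Chart_eq` (which concluded the same for any `SU`-field with the chart's matrices) AT (A4)'s chart letter.
[cite: Balaban1985Variational, (15) p.280, (20) p.281, (44)–(48) p.285, Prop. 6 (116) p.295; Balaban1987RG1, (0.21) p.256] -/
theorem iter_chartCfgLinFlat_eq (dom : Set (GaugeField (F.P K) k (SU N))) {εC B₀ C₄ a₃ j a𝔄 ε₄ b C₂ c₄ aC : ℝ}
    (R : Regime (frakGOfRecordAtBg128 F N K k Ω U₀ Gp Δ2 a hposπ hQ) (0 : Space115Lit F N K k Ω U₀ →L[ℂ] Space115Lit F N K k Ω U₀)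
      (WOfRecordAt F N K k Ω U₀ levB a hposb hQ εC Gp) B₀ 0 C₄ a₃ j a𝔄 ε₄)
    (hJ : ‖JOfRecordAtBg F N K k Ω U₀‖ ≤ j) {V : GaugeField (F.P K) k (SU N)} (h𝔄 : ‖frakAOfRecordAtBg128 F N K k Ω U₀ levB Gp Δ2 a hposπ hQ V‖ < a𝔄)
    (h𝔊 : FrakGSliceTok F N K k Ω U₀ Gp Δ2 a hposπ hQ)
    (RC : Regime (H1OfRecordAtBgFlat F N K k Ω U₀ levB a hposb hQ) (0 : Space115Lit F N K k Ω U₀ →L[ℂ] Space115Lit F N K k Ω U₀)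
      (CslOfRecord F N K k Ω U₀ levB) b 0 C₂ c₄ 0 aC εC)
    (haC : ε₄ + a𝔄 ≤ aC)
    (htr : ∀ b', (JetSup.equiv _ _ (nabla115 ((F.P K).eta k) (unitsOfRecord F N U₀))
        (T47 (H1OfRecordAtBgFlat F N K k Ω U₀ levB a hposb hQ) (CslOfRecord F N K k Ω U₀ levB) εC
          ((bgSchemeOfRecord F N K k Ω U₀ dom levB Gp Δ2 a hposπ hposb hQ εC B₀ C₄ a₃ j a𝔄 ε₄).sol V + frakAOfRecordAtBg128 F N K k Ω U₀ levB Gp Δ2 a hposπ hQ V)) b').trace = 0)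
    (hSU : ∀ b', (bgSchemeOfRecord F N K k Ω U₀ dom levB Gp Δ2 a hposπ hposb hQ εC B₀ C₄ a₃ j a𝔄 ε₄).expoLinAt
      (fun _ => T47 (H1OfRecordAtBgFlat F N K k Ω U₀ levB a hposb hQ) (CslOfRecord F N K k Ω U₀ levB) εC) V
        ((bgSchemeOfRecord F N K k Ω U₀ dom levB Gp Δ2 a hposπ hposb hQ εC B₀ C₄ a₃ j a𝔄 ε₄).sol V) b' ∈ Matrix.specialUnitaryGroup (Fin N) ℂ)
    (hguard : SmallBelow (avOfRecord F N K) k ((bgSchemeOfRecord F N K k Ω U₀ dom levB Gp Δ2 a hposπ hposb hQ εC B₀ C₄ a₃ j a𝔄 ε₄).chartCfgLin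
      (fun _ => T47 (H1OfRecordAtBgFlat F N K k Ω U₀ levB a hposb hQ) (CslOfRecord F N K k Ω U₀ levB) εC) V))
    (hdiscA : ∀ c, ‖iterMh k (coeField ((bgSchemeOfRecord F N K k Ω U₀ dom levB Gp Δ2 a hposπ hposb hQ εC B₀ C₄ a₃ j a𝔄 ε₄).chartCfgLin
        (fun _ => T47 (H1OfRecordAtBgFlat F N K k Ω U₀ levB a hposb hQ) (CslOfRecord F N K k Ω U₀ levB) εC) V)) c
        * star (Averaging.iter (avOfRecord F N K) k U₀ c : Matrix (Fin N) (Fin N) ℂ) - 1‖ < 1)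
    (hdiscV : V ∈ logDiscOfRecord F N K k U₀) :
    Averaging.iter (avOfRecord F N K) k ((bgSchemeOfRecord F N K k Ω U₀ dom levB Gp Δ2 a hposπ hposb hQ εC B₀ C₄ a₃ j a𝔄 ε₄).chartCfgLin
      (fun _ => T47 (H1OfRecordAtBgFlat F N K k Ω U₀ levB a hposb hQ) (CslOfRecord F N K k Ω U₀ levB) εC) V) = V := by
  have hU := coeField_chartLinFlat_eq_expOver F N K k Ω U₀ levB a hposb hQ Gp Δ2 hposπ dom V _ hSU
  rw [BgScheme.chartLin_sol] at hU
  exact iter_T47Chart_eq F N K k Ω U₀ levB a hposb hQ Gp Δ2 hposπ dom R hJ h𝔄 h𝔊 RC haC htr hU hguard hdiscA ((mem_logDiscOfRecord_iff F N K k U₀ V).1 hdiscV)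

/-! ## §2  The guard and the A-side log-disc row in the small, frame-free -/

omit [Fact (0 < (F.L : ℝ))] [Fact (0 < (F.P K).eta k)] [Fact (0 < c0Rec F K k)] [Fact (∀ c, 0 < wBRec F K k c)] in
/-- ★★ **GUARD AND A-SIDE LOG-DISC ROW NEAR `↑U₀`, FRAME-FREE**: for matrix fields `Q` near the matrices of a background guarded below `k`, every `SU(N)` configuration
with matrices `Q` is guarded below `k` (lit ✓`eventually_smallBelow`) and `‖Ū^k_h(Q)(c)·(Ū^kU₀)(c)⋆ − 1‖ < 1` at every level-`k` bond (`Ū^k_h` continuous at `↑U₀` with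
value `↑(Ū^kU₀)`, unitary). [cite: Balaban1987RG1, (0.4) p.253, (0.21) p.256; Balaban1985Averaging, (21) p.21] -/
theorem eventually_rowsFlat_nhds_bg (hU₀ : SmallBelow (avOfRecord F N K) k U₀) :
    ∀ᶠ Q in 𝓝 (coeField U₀), (∀ U : GaugeField (F.P K) 0 (SU N), coeField U = Q → SmallBelow (avOfRecord F N K) k U) ∧
      ∀ c : PBond (F.P K) k, ‖iterMh k Q c * star (Averaging.iter (avOfRecord F N K) k U₀ c : Matrix (Fin N) (Fin N) ℂ) - 1‖ < 1 := by
  have hguard : ∀ᶠ Q in 𝓝 (coeField U₀), ∀ U : GaugeField (F.P K) 0 (SU N), coeField U = Q → SmallBelow (avOfRecord F N K) k U :=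
    eventually_smallBelow hU₀
  have hpoly : ∀ j, j < k → ∀ (c : PBond (F.P K) (j + 1)) (i : Idx (F.P K)), ‖loopMh (iterMh j (coeField U₀)) c i - 1‖ < 1 :=
    fun j hj c i => lt_of_lt_of_le (norm_loopMh_iterMh_lt_of_smallBelow hU₀ j hj c i) deltaSU_le_one
  have hdisc : ∀ c : PBond (F.P K) k,
      ∀ᶠ Q in 𝓝 (coeField U₀), ‖iterMh k Q c * star (Averaging.iter (avOfRecord F N K) k U₀ c : Matrix (Fin N) (Fin N) ℂ) - 1‖ < 1 := by
    intro c
    have hit : ContinuousAt (fun Q : PBond (F.P K) 0 → Matrix (Fin N) (Fin N) ℂ => iterMh k Q c) (coeField U₀) :=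
      ((ContinuousLinearMap.proj (R := ℂ) (φ := fun _ : PBond (F.P K) k => Matrix (Fin N) (Fin N) ℂ) c).continuous.continuousAt).comp
        (analyticAt_iterMh_of_polydisc k hpoly).continuousAt
    have hcont : ContinuousAt (fun Q : PBond (F.P K) 0 → Matrix (Fin N) (Fin N) ℂ =>
        ‖iterMh k Q c * star (Averaging.iter (avOfRecord F N K) k U₀ c : Matrix (Fin N) (Fin N) ℂ) - 1‖) (coeField U₀) :=
      ((hit.mul continuousAt_const).sub continuousAt_const).norm
    have h0 : ‖iterMh k (coeField U₀) c * star (Averaging.iter (avOfRecord F N K) k U₀ c : Matrix (Fin N) (Fin N) ℂ) - 1‖ < 1 := by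
      rw [iterMh_coeField_of_smallBelow F N k U₀ hU₀, coeField_apply, coe_mul_star_coe_SU, sub_self, norm_zero]
      exact one_pos
    exact hcont.tendsto.eventually_lt_const h0
  filter_upwards [hguard, eventually_all.2 hdisc] with Q h₁ h₂
  exact ⟨h₁, h₂⟩

/-- ★ **THE FRAME-FREE CHART FIELD TENDS TO `↑U₀` AS `A′ → 0`** (lit ✓`analyticOnNhd_T47`, ✓`T47_zero` under the Sect. C regime; `evLit` linear; `expOver U₀ 0 = ↑U₀`).
[cite: Balaban1985Variational, (15) p.280, (47) p.285, Prop. 3 p.289] -/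
theorem tendsto_chartFieldFlat_zero {b C₂ c₄ aC εC : ℝ}
    (RC : Regime (H1OfRecordAtBgFlat F N K k Ω U₀ levB a hposb hQ) (0 : Space115Lit F N K k Ω U₀ →L[ℂ] Space115Lit F N K k Ω U₀)
      (CslOfRecord F N K k Ω U₀ levB) b 0 C₂ c₄ 0 aC εC)
    (hC : Prop4Hyp (CslOfRecord F N K k Ω U₀ levB) C₂ c₄) (haC : 0 < aC) :
    Tendsto (fun A' : Space115Lit F N K k Ω U₀ => expOver U₀ ((((F.P K).eta k : ℝ) : ℂ) • evLit F N K k Ω U₀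
        (T47 (H1OfRecordAtBgFlat F N K k Ω U₀ levB a hposb hQ) (CslOfRecord F N K k Ω U₀ levB) εC A'))) (𝓝 0) (𝓝 (coeField U₀)) := by
  have hT : ContinuousAt (T47 (H1OfRecordAtBgFlat F N K k Ω U₀ levB a hposb hQ) (CslOfRecord F N K k Ω U₀ levB) εC) 0 :=
    (analyticOnNhd_T47 RC hC 0 (mem_ball_self haC)).continuousAt
  have hev : AnalyticAt ℂ (fun Y : Space115Lit F N K k Ω U₀ => evLit F N K k Ω U₀ Y)
      (T47 (H1OfRecordAtBgFlat F N K k Ω U₀ levB a hposb hQ) (CslOfRecord F N K k Ω U₀ levB) εC 0) :=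
    (LinearMap.toContinuousLinearMap (evLit F N K k Ω U₀)).analyticAt _
  have hX : AnalyticAt ℂ (fun Y : Space115Lit F N K k Ω U₀ => (((F.P K).eta k : ℝ) : ℂ) • evLit F N K k Ω U₀ Y)
      (T47 (H1OfRecordAtBgFlat F N K k Ω U₀ levB a hposb hQ) (CslOfRecord F N K k Ω U₀ levB) εC 0) := hev.fun_const_smul
  have h := ((analyticAt_expOver U₀ _).continuousAt.comp (hX.continuousAt.comp hT)).tendsto
  simp only [Function.comp_def, T47_zero RC haC, map_zero, smul_zero, expOver_zero] at h
  exact h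

/-- ★★ **ONE RADIUS FOR THE TWO ROWS, FRAME-FREE**: there is `ρ > 0`, `ρ ≤ a_C` — from the guarded background and the Sect. C data only — such that for `‖A′‖ < ρ` every
`SU(N)` configuration carrying the chart field at `A′` is guarded below `k` and the field's holomorphic average lies in the log-disc about `Ū^kU₀`.
[cite: Balaban1987RG1, (0.4) p.253, (0.21) p.256; Balaban1985Variational, (47) p.285, Prop. 3 p.289] -/
theorem exists_radius_rowsFlat (hU₀ : SmallBelow (avOfRecord F N K) k U₀) {b C₂ c₄ aC εC : ℝ}
    (RC : Regime (H1OfRecordAtBgFlat F N K k Ω U₀ levB a hposb hQ) (0 : Space115Lit F N K k Ω U₀ →L[ℂ] Space115Lit F N K k Ω U₀)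
      (CslOfRecord F N K k Ω U₀ levB) b 0 C₂ c₄ 0 aC εC)
    (hC : Prop4Hyp (CslOfRecord F N K k Ω U₀ levB) C₂ c₄) (haC : 0 < aC) :
    ∃ ρ : ℝ, 0 < ρ ∧ ρ ≤ aC ∧ ∀ A' : Space115Lit F N K k Ω U₀, ‖A'‖ < ρ →
      (∀ U : GaugeField (F.P K) 0 (SU N), coeField U = expOver U₀ ((((F.P K).eta k : ℝ) : ℂ) • evLit F N K k Ω U₀
          (T47 (H1OfRecordAtBgFlat F N K k Ω U₀ levB a hposb hQ) (CslOfRecord F N K k Ω U₀ levB) εC A')) → SmallBelow (avOfRecord F N K) k U) ∧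
      ∀ c : PBond (F.P K) k, ‖iterMh k (expOver U₀ ((((F.P K).eta k : ℝ) : ℂ) • evLit F N K k Ω U₀
          (T47 (H1OfRecordAtBgFlat F N K k Ω U₀ levB a hposb hQ) (CslOfRecord F N K k Ω U₀ levB) εC A'))) c
        * star (Averaging.iter (avOfRecord F N K) k U₀ c : Matrix (Fin N) (Fin N) ℂ) - 1‖ < 1 := by
  have h := (tendsto_chartFieldFlat_zero F N K k Ω U₀ levB a hposb hQ RC hC haC).eventually (eventually_rowsFlat_nhds_bg F N K k U₀ hU₀)
  obtain ⟨ε, hε, hball⟩ := Metric.eventually_nhds_iff.1 h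
  refine ⟨min ε aC, lt_min hε haC, min_le_right _ _, fun A' hA' => ?_⟩
  exact hball (by rw [dist_zero_right]; exact lt_of_lt_of_le hA' (min_le_left _ _))

/-- ★★★ **(rng) ∧ (star_mem)'s AVERAGE CONJUNCT AT THE FIXED POINT, GUARD AND A-SIDE LOG-DISC ROW DISCHARGED, FRAME-FREE**: one radius `ρ > 0` (background + Sect. C data)
such that for EVERY scheme regime with `ε₄ + a𝔄 ≤ ρ` and every `V` in the log-disc with `‖𝔄♭V‖ < a𝔄`, the slice token, the trace row and the `SU`-exponent row give
`Ū^k(𝔖♭.chartCfgLin T♭ V) = V`. [cite: Balaban1985Variational, (20) p.281, (44)–(48) p.285, (109)–(111) p.294, Prop. 6 (115)–(116) p.295; Balaban1987RG1, (0.21) p.256] -/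
theorem exists_radius_iter_chartCfgLinFlat_eq (dom : Set (GaugeField (F.P K) k (SU N))) (hU₀ : SmallBelow (avOfRecord F N K) k U₀) {εC b C₂ c₄ aC : ℝ}
    (RC : Regime (H1OfRecordAtBgFlat F N K k Ω U₀ levB a hposb hQ) (0 : Space115Lit F N K k Ω U₀ →L[ℂ] Space115Lit F N K k Ω U₀)
      (CslOfRecord F N K k Ω U₀ levB) b 0 C₂ c₄ 0 aC εC)
    (hC : Prop4Hyp (CslOfRecord F N K k Ω U₀ levB) C₂ c₄) (haC : 0 < aC) :
    ∃ ρ : ℝ, 0 < ρ ∧ ρ ≤ aC ∧ ∀ (B₀ C₄ a₃ j a𝔄 ε₄ : ℝ), ε₄ + a𝔄 ≤ ρ →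
      Regime (frakGOfRecordAtBg128 F N K k Ω U₀ Gp Δ2 a hposπ hQ) (0 : Space115Lit F N K k Ω U₀ →L[ℂ] Space115Lit F N K k Ω U₀)
        (WOfRecordAt F N K k Ω U₀ levB a hposb hQ εC Gp) B₀ 0 C₄ a₃ j a𝔄 ε₄ →
      ‖JOfRecordAtBg F N K k Ω U₀‖ ≤ j → FrakGSliceTok F N K k Ω U₀ Gp Δ2 a hposπ hQ →
      ∀ {V : GaugeField (F.P K) k (SU N)}, V ∈ logDiscOfRecord F N K k U₀ → ‖frakAOfRecordAtBg128 F N K k Ω U₀ levB Gp Δ2 a hposπ hQ V‖ < a𝔄 →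
      (∀ b', (JetSup.equiv _ _ (nabla115 ((F.P K).eta k) (unitsOfRecord F N U₀))
        (T47 (H1OfRecordAtBgFlat F N K k Ω U₀ levB a hposb hQ) (CslOfRecord F N K k Ω U₀ levB) εC
          ((bgSchemeOfRecord F N K k Ω U₀ dom levB Gp Δ2 a hposπ hposb hQ εC B₀ C₄ a₃ j a𝔄 ε₄).sol V + frakAOfRecordAtBg128 F N K k Ω U₀ levB Gp Δ2 a hposπ hQ V)) b').trace = 0) →
      (∀ b', (bgSchemeOfRecord F N K k Ω U₀ dom levB Gp Δ2 a hposπ hposb hQ εC B₀ C₄ a₃ j a𝔄 ε₄).expoLinAt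
        (fun _ => T47 (H1OfRecordAtBgFlat F N K k Ω U₀ levB a hposb hQ) (CslOfRecord F N K k Ω U₀ levB) εC) V
          ((bgSchemeOfRecord F N K k Ω U₀ dom levB Gp Δ2 a hposπ hposb hQ εC B₀ C₄ a₃ j a𝔄 ε₄).sol V) b' ∈ Matrix.specialUnitaryGroup (Fin N) ℂ) →
      Averaging.iter (avOfRecord F N K) k ((bgSchemeOfRecord F N K k Ω U₀ dom levB Gp Δ2 a hposπ hposb hQ εC B₀ C₄ a₃ j a𝔄 ε₄).chartCfgLin
        (fun _ => T47 (H1OfRecordAtBgFlat F N K k Ω U₀ levB a hposb hQ) (CslOfRecord F N K k Ω U₀ levB) εC) V) = V := by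
  obtain ⟨ρ, hρ, hρaC, hrows⟩ := exists_radius_rowsFlat F N K k Ω U₀ levB a hposb hQ hU₀ RC hC haC
  refine ⟨ρ, hρ, hρaC, fun B₀ C₄ a₃ j a𝔄 ε₄ hfit R hJ h𝔊 V hV h𝔄 htr hSU => ?_⟩
  have hsol : ‖(bgSchemeOfRecord F N K k Ω U₀ dom levB Gp Δ2 a hposπ hposb hQ εC B₀ C₄ a₃ j a𝔄 ε₄).sol V‖ ≤ ε₄ :=
    (bgSchemeOfRecord_sol_spec F N K k Ω U₀ levB Gp Δ2 a hposπ hposb hQ dom R hJ h𝔄).1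
  have hA : ‖(bgSchemeOfRecord F N K k Ω U₀ dom levB Gp Δ2 a hposπ hposb hQ εC B₀ C₄ a₃ j a𝔄 ε₄).sol V +
      frakAOfRecordAtBg128 F N K k Ω U₀ levB Gp Δ2 a hposπ hQ V‖ < ρ :=
    lt_of_lt_of_le (lt_of_le_of_lt (norm_add_le _ _) (by linarith)) hfit
  obtain ⟨hguard, hdiscA⟩ := hrows _ hA
  have hcoe := coeField_chartLinFlat_eq_expOver F N K k Ω U₀ levB a hposb hQ Gp Δ2 hposπ dom V _ hSU
  rw [BgScheme.chartLin_sol] at hcoe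
  rw [← hcoe] at hdiscA
  exact iter_chartCfgLinFlat_eq F N K k Ω U₀ levB a hposb hQ Gp Δ2 hposπ dom R hJ h𝔄 h𝔊 RC (hfit.trans hρaC) htr hSU (hguard _ hcoe) hdiscA hV

end Record

end Summit.QuantumFields.YangMills.Theorems.N07ChartLinAverageFlat

end
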